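/-
Copyright (c) 2026. All rights reserved.
Released under Apache 2.0 license as described in the file LICENSE.
Authors: abc-iut cell, seat abc-iut-L4-t9 (gen 6; [AbsTopIII] Prop 3.2 (v) ↔ (iv), residual identification).
-/
import Literature.AnabelianGeometry.AbsoluteAnabelian.MLFGaloisLogFrobeniusFactorizationIso
import Literature.AnabelianGeometry.AbsoluteAnabelian.MonoidKummerMapsStrictlyBelyiTMLift
import Literature.AnabelianGeometry.AbsoluteAnabelian.MonoidKummerMapsMonoAnalyticLiftHolds
import Literature.AnabelianGeometry.AbsoluteAnabelian.MonoidKummerMapsProofs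
import Literature.AnabelianGeometry.AbsoluteAnabelian.MLFClosureUnitsAnchorProofs
import Literature.AnabelianGeometry.AbsoluteAnabelian.MLFGaloisForgetfulFunctors

/-!
# [AbsTopIII] Prop 3.2 (v) on the isomorphism subcategories: its residual IS the `TF` bijectivity
# clause of Prop 3.2 (iv) (the schema `GaloisIsoLiftsToTFPairIsoOfStrictlyBelyi`), restricted to `S`

S. Mochizuki, *Topics in absolute anabelian geometry III* [MochizukiAbsTopIII2015] (kurims manuscript
`paper:url-5493eb38cbb7`, read on the page).  Prop 3.2 (iv) p. 72 l. 16–21: "the natural functor of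
Definition 3.1, (iii), induces an injection `Isom((Π ↷ M_T), (Π* ↷ M*_T)) ↪ Isom_{𝒯𝒢}(Π, Π*)` [...] this
injection is a bijection if [...] `(Π ↷ M_T)`, `(Π* ↷ M*_T)` are of strictly Belyi type"; Prop 3.2 (v)
p. 72 l. 29–42: "The algorithm of (iii) yields a natural [1-]factorization
`𝒞^{MLF-sB}_TF ⟶ 𝒞^{MLF-sB}_T ⟶ 𝒞^{MLF-sB}_{T′}` [...] the functor `𝔩𝔬𝔤_{T,T}` is isomorphic to the identity
functor [hence, in particular, is an equivalence of categories]".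

PROOF-ONLY companion (theorems only, no new definitions) of this seat's
`MLFGaloisLogFrobeniusFactorizationIso.lean` (gen 5), whose residual for (v) read on the ISOMORPHISM
subcategories is `nonempty_prop32iiiAlgorithmIso_iff_full : Nonempty (Prop32iiiAlgorithmIso S) ↔
(tfToTMOnCore S).Full` ("every isomorphism `(Π ↷ 𝒪^⊳) ⥲ (Π′ ↷ 𝒪′^⊳)` between `S`-pairs lifts to the
fields"), and of abc-iut-w4-d045's `MonoidKummerMapsSub.lean`, which types the strictly-Belyi `TF`
bijectivity clause of (iv) as the schema `GaloisIsoLiftsToTFPairIsoOfStrictlyBelyi H` (FACT-LIST F-2995;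
sub-DAG row P32.iv.L16 of `plan/L4/SUBDAG-AbsTopIII-Prop32.md`).  We prove that THESE TWO RESIDUALS ARE
ONE: for every `S : ObjectProperty 𝒞^c_TF` (universe `0`, where the model pairs live),

  `(tfToTMOnCore S).Full ↔ GaloisIsoLiftsToTFPairIsoOfStrictlyBelyi (· ∈ S)`

(`full_tfToTMOnCore_iff_galoisIsoLiftsToTFPairIso`), where `(· ∈ S)` is the hypothesis predicate "an
MLF-Galois `TF`-pair with compact `Π` lying in `S`" (written inline, no new definition), hence

  `Nonempty (Prop32iiiAlgorithmIso S) ↔ GaloisIsoLiftsToTFPairIsoOfStrictlyBelyi (· ∈ S)`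

(`nonempty_prop32iiiAlgorithmIso_iff_galoisIsoLiftsToTFPairIso`): the algorithm of (iii) exists as a
functorial datum on isomorphisms of `S`-pairs IFF the `TF` bijectivity clause of (iv) holds on `S`.

The two directions and their printed inputs:
* (⇐) `full_tfToTMOnCore_of_galoisIsoLiftsToTFPairIso`: an isomorphism of `TM`-pairs between the
  integers of two `S`-pairs has a Galois component respecting the arithmetic quotients
  (`GaloisMonoidPair.Iso.map_actionKer`, and `(Π ↷ 𝒪^⊳)`, `(Π ↷ k̄)` have the same arithmetic quotient,
  `GaloisFieldPair.actionKer_integersPair`); the schema lifts it to an isomorphism of `TF`-pairs; the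
  two resulting `TM`-isomorphisms have the same Galois component, hence coincide by the INJECTIVITY clause
  of (iv) for `T = TM` (`pairIsoDeterminedByGalois_holds`, abc-iut-L6-t13, PROVED — row P32.iv.L13).
* (⇒) `galoisIsoLiftsToTFPairIso_of_full_tfToTMOnCore`: an admissible `f : Π ⥲ Π*` lifts to the integer
  pairs UNCONDITIONALLY for compact `Π` (`galoisIsoLiftsToTMPairIso_of_compact_holds`, the local class
  field theory route of the printed proof p. 72 l. 50 – p. 73 l. 2; abc-iut-L6-t13 / F-0409), and
  fullness lifts that `TM`-isomorphism to the fields, with the same Galois component (`tfToTM_homPi`).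
Also: the schema is ANTITONE in its hypothesis predicate (`galoisIsoLiftsToTFPairIsoOfStrictlyBelyi_anti`),
and at `S = ⊤` the residual is the schema at the bare predicate "MLF-Galois with compact `Π`"
(`full_tfToTMOnCore_top_iff`).

BOOKKEEPING CONSEQUENCE (ours): sub-DAG rows P32.v.L18 (functor level of (v), on isomorphisms) and
P32.iv.L16-`TF` carry ONE named residual — F-2995, whose intended instance (strictly Belyi type) is
Cor 1.10 (h) / [AbsTopI] Thm 2.6 (campaign L) — not two.  HONEST FRAMING: refereed pre-IUT material; OUR
kernel theorems about OUR typings; a residual identification is bookkeeping, not a discharge; F-2995 is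
neither asserted nor refuted here.  No instance, no notation, no definition.  Nothing here bears on
[IUTchIII] Cor 3.12 or takes a side; typed ≠ proved.
-/

noncomputable section

namespace Literature.AnabelianGeometry.AbsoluteAnabelian

open _root_.CategoryTheory

/-! ## The schema `GaloisIsoLiftsToTFPairIsoOfStrictlyBelyi H` is antitone in `H` -/

/-- **Prop 3.2 (iv), `TF` bijectivity schema: antitone in the hypothesis predicate** — if every `H′`-pair is an
`H`-pair, the schema at `H` implies the schema at `H′` (fewer pairs to lift between).
[cite: MochizukiAbsTopIII2015, Proposition 3.2 (iv) p.72] -/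
theorem galoisIsoLiftsToTFPairIsoOfStrictlyBelyi_anti {H H' : GaloisFieldPair.{0} → Prop}
    (hHH' : ∀ P, H' P → H P) (h : GaloisIsoLiftsToTFPairIsoOfStrictlyBelyi H) :
    GaloisIsoLiftsToTFPairIsoOfStrictlyBelyi H' :=
  fun P Q hP hQ hHP hHQ f hf => h P Q hP hQ (hHH' P hHP) (hHH' Q hHQ) f hf

/-- Two pointwise-equivalent hypothesis predicates give equivalent schemata.
[cite: MochizukiAbsTopIII2015, Proposition 3.2 (iv) p.72] -/
theorem galoisIsoLiftsToTFPairIsoOfStrictlyBelyi_congr {H H' : GaloisFieldPair.{0} → Prop}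
    (hHH' : ∀ P, H P ↔ H' P) :
    GaloisIsoLiftsToTFPairIsoOfStrictlyBelyi H ↔ GaloisIsoLiftsToTFPairIsoOfStrictlyBelyi H' :=
  ⟨galoisIsoLiftsToTFPairIsoOfStrictlyBelyi_anti fun P h => (hHH' P).mpr h,
    galoisIsoLiftsToTFPairIsoOfStrictlyBelyi_anti fun P h => (hHH' P).mp h⟩

/-! ## (⇐) From the `TF` bijectivity schema on `S` to fullness on isomorphisms -/

variable (S : ObjectProperty MLFGaloisFieldPairCompactCat.{0})

/-- **(⇐) If every admissible `Π ⥲ Π*` between `S`-pairs lifts to the fields (Prop 3.2 (iv), `TF` clause, on `S`),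
then `𝒞̳^{S}_TF → 𝒞̳^{S}_TM` is full**: an isomorphism `(Π ↷ 𝒪^⊳) ⥲ (Π* ↷ 𝒪*^⊳)` between the integers of two
`S`-pairs has an admissible Galois component (pair isomorphisms respect the arithmetic quotients, which agree
for `(Π ↷ k̄)` and `(Π ↷ 𝒪^⊳)`), the schema lifts it to `(Π ↷ k̄) ⥲ (Π* ↷ k̄*)`, and the integers of that lift
ARE the given isomorphism by the injectivity clause of (iv) for `T = TM` (`pairIsoDeterminedByGalois_holds`).
[cite: MochizukiAbsTopIII2015, Proposition 3.2 (iv) p.72] -/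
theorem full_tfToTMOnCore_of_galoisIsoLiftsToTFPairIso
    (h : GaloisIsoLiftsToTFPairIsoOfStrictlyBelyi
      (fun P => ∃ hP : IsMLFGaloisFieldPair P ∧ CompactSpace P.Pi, S ⟨P, hP⟩)) :
    (tfToTMOnCore S).Full := by
  refine ⟨fun {X Y} g => ?_⟩
  -- the underlying `TF`-pairs and their properties
  have hX : IsMLFGaloisFieldPair X.of.obj.obj := X.of.obj.property.1
  have hY : IsMLFGaloisFieldPair Y.of.obj.obj := Y.of.obj.property.1
  -- the given isomorphism of `TM`-pairs, pushed down to the category of all pairs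
  let a : X.of.obj.obj.integersPair hX ≅ Y.of.obj.obj.integersPair hY :=
    ((tmPairsOf S).ι ⋙ MLFGaloisMonoidPairCompactCat.incl .TM).mapIso g.iso
  let e₀ : GaloisMonoidPair.Iso (X.of.obj.obj.integersPair hX) (Y.of.obj.obj.integersPair hY) :=
    GaloisMonoidPair.isoOfCatIso a
  -- its Galois component respects the arithmetic quotients of the `TF`-pairs
  let f : X.of.obj.obj.Pi ≃ₜ* Y.of.obj.obj.Pi := e₀.isoPi
  have hf : X.of.obj.obj.actionKer.map f.toMulEquiv.toMonoidHom = Y.of.obj.obj.actionKer := by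
    have h1 := e₀.map_actionKer
    rw [GaloisFieldPair.actionKer_integersPair, GaloisFieldPair.actionKer_integersPair] at h1
    exact h1
  -- lift to the fields
  obtain ⟨e, he⟩ := h X.of.obj.obj Y.of.obj.obj hX hY ⟨X.of.obj.property, X.of.property⟩
    ⟨Y.of.obj.property, Y.of.property⟩ f hf
  -- the integers of the lift coincide with the given `TM`-isomorphism (injectivity clause of (iv))
  have hM : (e.integers hX hY).isoM = e₀.isoM :=
    pairIsoDeterminedByGalois_holds _ _ (GaloisFieldPair.isMLFGaloisMonoidPair_TM_integersPair hX)
      (GaloisFieldPair.isMLFGaloisMonoidPair_TM_integersPair hY) _ _ (by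
        ext x
        change e.isoPi x = f x
        rw [he])
  -- the lift as a morphism of the isomorphism subcategory
  let i₁ : X.of.obj ≅ Y.of.obj := ObjectProperty.isoMk _ e.toCatIso
  let i₂ : X.of ≅ Y.of := ObjectProperty.isoMk _ i₁
  refine ⟨CoreHom.mk i₂, Core.hom_ext ?_⟩
  -- compare the underlying morphisms of pairs
  apply InducedCategory.hom_ext
  apply InducedCategory.hom_ext
  refine GaloisMonoidPair.Hom.ext (MonoidHom.ext fun x => ?_) (MonoidHom.ext fun m => ?_)
  · change e.isoPi x = f x
    rw [he]
  · change (e.integers hX hY).isoM m = e₀.isoM m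
    rw [hM]

/-! ## (⇒) From fullness on isomorphisms to the `TF` bijectivity schema on `S` -/

/-- **(⇒) If `𝒞̳^{S}_TF → 𝒞̳^{S}_TM` is full, every admissible `Π ⥲ Π*` between `S`-pairs lifts to the fields**:
the `TM` lift exists unconditionally for compact `Π` (`galoisIsoLiftsToTMPairIso_of_compact_holds`, local class
field theory), and fullness lifts it to an isomorphism of `TF`-pairs with the same Galois component.
[cite: MochizukiAbsTopIII2015, Proposition 3.2 (iv) p.72] -/
theorem galoisIsoLiftsToTFPairIso_of_full_tfToTMOnCore (h : (tfToTMOnCore S).Full) :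
    GaloisIsoLiftsToTFPairIsoOfStrictlyBelyi
      (fun P => ∃ hP : IsMLFGaloisFieldPair P ∧ CompactSpace P.Pi, S ⟨P, hP⟩) := by
  intro P Q _ _ hHP hHQ f hf
  obtain ⟨hP, hSP⟩ := hHP
  obtain ⟨hQ, hSQ⟩ := hHQ
  -- the two objects of the isomorphism subcategory
  let X : Core S.FullSubcategory := ⟨⟨⟨P, hP⟩, hSP⟩⟩
  let Y : Core S.FullSubcategory := ⟨⟨⟨Q, hQ⟩, hSQ⟩⟩
  -- the `TM` lift of `f` (unconditional for compact `Π`)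
  have hf' : (P.integersPair hP.1).actionKer.map f.toMulEquiv.toMonoidHom = (Q.integersPair hQ.1).actionKer := by
    rw [GaloisFieldPair.actionKer_integersPair, GaloisFieldPair.actionKer_integersPair]
    exact hf
  obtain ⟨e₀, he₀⟩ := galoisIsoLiftsToTMPairIso_of_compact_holds (fun R => CompactSpace R.Pi) (fun _ hR => hR)
    (P.integersPair hP.1) (Q.integersPair hQ.1) (GaloisFieldPair.isMLFGaloisMonoidPair_TM_integersPair hP.1)
    (GaloisFieldPair.isMLFGaloisMonoidPair_TM_integersPair hQ.1) hP.2 hQ.2 f hf'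
  -- as a morphism `(tfToTMOnCore S).obj X ⟶ (tfToTMOnCore S).obj Y`
  let j₁ : tfToTMCompact.obj X.of.obj ≅ tfToTMCompact.obj Y.of.obj := ObjectProperty.isoMk _ e₀.toCatIso
  let j₂ : (tfToTMOn S).obj X.of ≅ (tfToTMOn S).obj Y.of := ObjectProperty.isoMk _ j₁
  let g : (tfToTMOnCore S).obj X ⟶ (tfToTMOnCore S).obj Y := CoreHom.mk j₂
  -- fullness: a preimage in the isomorphism subcategory of `𝒞^{S}_TF`
  obtain ⟨ĝ, hĝ⟩ := h.map_surjective g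
  let e : GaloisFieldPair.Iso P Q :=
    GaloisFieldPair.isoOfCatIso ((S.ι ⋙ MLFGaloisFieldPairCompactCat.incl).mapIso ĝ.iso)
  refine ⟨e, ?_⟩
  ext x
  have h1 := congrArg
    (fun γ : (tfToTMOnCore S).obj X ⟶ (tfToTMOnCore S).obj Y => γ.iso.hom.hom.hom.homPi x) hĝ
  change GaloisFieldPair.Hom.homPi (P := P) (Q := Q) ĝ.iso.hom.hom.hom x = e₀.isoPi x at h1
  rw [he₀] at h1
  exact h1

/-! ## The identification -/

/-- **THE RESIDUAL OF Prop 3.2 (v) ON ISOMORPHISMS = THE `TF` BIJECTIVITY CLAUSE OF Prop 3.2 (iv) ON `S`**: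
`𝒞̳^{S}_TF → 𝒞̳^{S}_TM` is full iff the schema `GaloisIsoLiftsToTFPairIsoOfStrictlyBelyi` holds at the hypothesis
predicate "lies in `S`" (for `S` = strictly Belyi type: print's (iv)/(v) via (iii) = Cor 1.10 (h); campaign L; NOT
asserted). [cite: MochizukiAbsTopIII2015, Proposition 3.2 (iv) p.72] -/
theorem full_tfToTMOnCore_iff_galoisIsoLiftsToTFPairIso :
    (tfToTMOnCore S).Full ↔ GaloisIsoLiftsToTFPairIsoOfStrictlyBelyi
      (fun P => ∃ hP : IsMLFGaloisFieldPair P ∧ CompactSpace P.Pi, S ⟨P, hP⟩) :=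
  ⟨galoisIsoLiftsToTFPairIso_of_full_tfToTMOnCore S, full_tfToTMOnCore_of_galoisIsoLiftsToTFPairIso S⟩

/-- **Prop 3.2 (v) ↔ Prop 3.2 (iv) on `S`-pairs**: "the algorithm of (iii)" exists as a functorial datum on
isomorphisms of `S`-pairs (`Prop32iiiAlgorithmIso S`: a quasi-inverse of `𝒞̳^{S}_TF → 𝒞̳^{S}_TM`, whence print's
1-factorization and "`𝔩𝔬𝔤_{TM,TM}` is isomorphic to the identity functor") IFF the `TF` bijectivity clause of (iv)
holds on `S`. [cite: MochizukiAbsTopIII2015, Proposition 3.2 (v) p.72] -/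
theorem nonempty_prop32iiiAlgorithmIso_iff_galoisIsoLiftsToTFPairIso :
    Nonempty (Prop32iiiAlgorithmIso S) ↔ GaloisIsoLiftsToTFPairIsoOfStrictlyBelyi
      (fun P => ∃ hP : IsMLFGaloisFieldPair P ∧ CompactSpace P.Pi, S ⟨P, hP⟩) :=
  (nonempty_prop32iiiAlgorithmIso_iff_full S).trans (full_tfToTMOnCore_iff_galoisIsoLiftsToTFPairIso S)

/-- **At `S = ⊤`** (all MLF-Galois `TF`-pairs with compact `Π`): `𝒞̳^c_TF → 𝒞̳^c_TM` is full iff the schema holds at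
the bare predicate "MLF-Galois with compact `Π`" (no type hypothesis at all — the universal closure of F-2995 over
compact `Π`; print restricts to strictly Belyi type). [cite: MochizukiAbsTopIII2015, Proposition 3.2 (iv) p.72] -/
theorem full_tfToTMOnCore_top_iff :
    (tfToTMOnCore (⊤ : ObjectProperty MLFGaloisFieldPairCompactCat.{0})).Full ↔
      GaloisIsoLiftsToTFPairIsoOfStrictlyBelyi (fun P => IsMLFGaloisFieldPair P ∧ CompactSpace P.Pi) :=
  (full_tfToTMOnCore_iff_galoisIsoLiftsToTFPairIso ⊤).trans
    (galoisIsoLiftsToTFPairIsoOfStrictlyBelyi_congr fun _ =>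
      ⟨fun ⟨hP, _⟩ => hP, fun hP => ⟨hP, trivial⟩⟩)

/-- Hence, at `S = ⊤`: the algorithm of (iii) exists as a functorial datum on ALL isomorphisms of compact-`Π` pairs
iff EVERY admissible `Π ⥲ Π*` between MLF-Galois `TF`-pairs with compact `Π` lifts to the fields.
[cite: MochizukiAbsTopIII2015, Proposition 3.2 (v) p.72] -/
theorem nonempty_prop32iiiAlgorithmIso_top_iff :
    Nonempty (Prop32iiiAlgorithmIso (⊤ : ObjectProperty MLFGaloisFieldPairCompactCat.{0})) ↔
      GaloisIsoLiftsToTFPairIsoOfStrictlyBelyi (fun P => IsMLFGaloisFieldPair P ∧ CompactSpace P.Pi) :=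
  (nonempty_prop32iiiAlgorithmIso_iff_full ⊤).trans full_tfToTMOnCore_top_iff

end Literature.AnabelianGeometry.AbsoluteAnabelian

end
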